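import Summits.HubbardSuperconductivity.HubbardSuperconductivity.Theorems.AnisotropyChordTransferFibre3FinX3Eval

/-!
# Route `AnisotropyChord` / H0 rotor rung: FIN per-`L` GM₃ (X5), `L = 28` — rows `N₁` / D / side-condition cell facts, part `p51`

Kernel facts (`decide +kernel`) for cert cells 121, 122 of the per-`L` grid of `L = 28`: `xbnCellAny2` (row `N₁` on XB2 point wedges recomputed in the kernel, exporting the literal brackets `nt ⊇ T⁺ − 3λ₂` and `tb ⊇ T⁺·D`), `xdCellAnyN0` (row D, reads `nt`), `sdCellAnyZN` (side condition, reads `nt`); evaluators `…FinX3Eval` / `…FinX5Eval`; constants from the compiled design probe (x3probe/x3plan, margins c ×0.985, b ×1.03, aD ×1.03); assembled in `…FinX5GM3TwentyEight`.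
Prover seat `hubbard-h0-rotor-p3` g8; helper for piece A = stmt-HubbardSuperconductivity-23918 of rung 19089 (`--supports`, helper class).
WHAT THIS IS NOT: nothing here proves superconductivity in the Hubbard model (rotor TARGET as worded stays FALSE, g15 verdict); kernel facts for the FIN certificate of ONE conditional reduction.  Tree imports only; zero data; standard axioms.
-/

set_option linter.dupNamespace false
set_option autoImplicit false

namespace Summit.HubbardSuperconductivity.HubbardSuperconductivity.Theorems.AnisotropyChord.Transfer.Fibre3

namespace FinXD

open FinXB FinCell Hole2

set_option maxHeartbeats 4000000 in
/-- row `N₁` of cell 121 of `L = 28` (`c = 29/50`), exporting `nt`, `tb`. [folklore] -/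
theorem xn28_121 : xbnCellAny2 28 (49/50 : ℚ) 1351664317996156 1385455925946060 (29/50 : ℚ) ((17662006799631 : ℤ), (27648463920149 : ℤ)) ((4072630211075245 : ℤ), (4184040991471183 : ℤ)) = true := by decide +kernel

set_option maxHeartbeats 4000000 in
/-- row D of cell 121 of `L = 28` (`aD = 39/500`). [folklore] -/
theorem xd28_121 : xdCellAnyN0 28 (49/50 : ℚ) 1351664317996156 1385455925946060 (39/500 : ℚ) ((17662006799631 : ℤ), (27648463920149 : ℤ)) = true := by decide +kernel

set_option maxHeartbeats 4000000 in
/-- side condition of cell 121 of `L = 28` (`c, b = 101/100, aD`). [folklore] -/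
theorem sd28_121 : sdCellAnyZN 28 (49/50 : ℚ) 100 1351664317996156 1385455925946060 ((29/50 : ℚ), (101 : ℕ), (39/500 : ℚ)) ((17662006799631 : ℤ), (27648463920149 : ℤ)) = true := by decide +kernel

set_option maxHeartbeats 4000000 in
/-- row `N₁` of cell 122 of `L = 28` (`c = 23/40`), exporting `nt`, `tb`. [folklore] -/
theorem xn28_122 : xbnCellAny2 28 (49/50 : ℚ) 1385455925946060 1420092324094712 (23/40 : ℚ) ((19000787838264 : ℤ), (29522336380437 : ℤ)) ((4175343197220768 : ℤ), (4289824677120249 : ℤ)) = true := by decide +kernel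

set_option maxHeartbeats 4000000 in
/-- row D of cell 122 of `L = 28` (`aD = 39/500`). [folklore] -/
theorem xd28_122 : xdCellAnyN0 28 (49/50 : ℚ) 1385455925946060 1420092324094712 (39/500 : ℚ) ((19000787838264 : ℤ), (29522336380437 : ℤ)) = true := by decide +kernel

set_option maxHeartbeats 4000000 in
/-- side condition of cell 122 of `L = 28` (`c, b = 102/100, aD`). [folklore] -/
theorem sd28_122 : sdCellAnyZN 28 (49/50 : ℚ) 100 1385455925946060 1420092324094712 ((23/40 : ℚ), (102 : ℕ), (39/500 : ℚ)) ((19000787838264 : ℤ), (29522336380437 : ℤ)) = true := by decide +kernel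

end FinXD

end Summit.HubbardSuperconductivity.HubbardSuperconductivity.Theorems.AnisotropyChord.Transfer.Fibre3
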